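import Summits.QuantumFields.YangMills.Theorems.BalabanUVNodesN08AlphaProfileEnd

/-!
# Route «BalabanUVNodes», Track-A DAG node N08 = [Balaban1985UV3] — (α) clause: N08 BY NAME AT THE C-BINDING OVER THE CONSTRUCTED RUNS, from the DATA schema
# and STRUCTURE ALONE (the in-edge side discharged uniformly in the lattice approximation)

Cell `pub-ymgap`, seat `pub-ymgap-dag-n08-d` gen 5, file F7b (over F7 `…ProfileEnd` and gen 4's `…CompactEnd`).  `bears_on: R4∕N08`; filed `--supports
stmt-QuantumFields-19910 --as helper`.  Sorry-free, standard axioms.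

★★ `exists_externalInputs_b10_main_family_of_structure` — gen 4's `…CompactEnd.exists_externalInputs_b10_main_family_of_nonempty` with its displayed in-edge
hypotheses ((b7) `hcont`, (b11′) `hne`, the `h`-large data) REPLACED by F7's per-approximation END (`exists_externalInputs_runAlpha_of_structure_window`): for every
lattice approximation `S` there are external inputs `X S` (standard averaging, same regular classes as `X₀ S`, measurable `U_k(·,h)`, `InEdgeFaces₃ 𝔊 (regMin 𝔠) (X S)`) such
that (i) the DATA schema on the N08 family gives `RunAlpha 𝔊 𝔠 (X S)`, and (ii) for every C-binding world bound over the printed carriers whose B10 runs are the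
constructed towers `towerOf 𝔠.lane (X S) (𝔖 S)` on `ScalesLE L ((min γ_N08 1)²)`, the DATA schema on the family yields `Dag.B10_main (leavesP w P)` — from STRUCTURAL
hypotheses only (uniform in `S`: `X ∈ 𝔤 ∖ 0`, `min C68 (2L²B₃) ≥ 4π`, and for `j < S.K`: `α_j ≤ ¼`, [4]'s window, collars `≥ 14`).
HONEST FRAMING: the DATA schema (`RunDataRows`: the cluster expansion of [B10]∕[8]–[10], classes II + III of the census) stays DISPLAYED — it is the object gap of
N08; count-neutral; NOT a discharge of N08.  d = 3 lattice gauge theory on finite tori as printed; nothing about d = 4, the continuum, OS axioms, a mass gap or Clay.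
-/

noncomputable section

namespace Summit.QuantumFields.YangMills.Theorems.BalabanUVNodesN08AlphaProfileFamily

open MeasureTheory Set Topology TopologicalSpace
open scoped Matrix Matrix.Norms.L2Operator
open Literature.MathematicalPhysics.QuantumFieldTheory.Balaban1983to89
open Literature.MathematicalPhysics.QuantumFieldTheory.Balaban1983to89.B10 (pFun)
open Literature.MathematicalPhysics.QuantumFieldTheory.Balaban1983to89.B10SectCExpansion (TermSizes)
open Literature.MathematicalPhysics.QuantumFieldTheory.Balaban1985CMP102
open Literature.MathematicalPhysics.QuantumFieldTheory.Balaban1985CMP102.Setting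
open Literature.MathematicalPhysics.QuantumFieldTheory.Balaban1983to89.DagBinding (leavesP WorldP PrintedCarriersR PrintedCarriers9X
  PrintedCarriers11 PrintedCarriers14R PrintedCarriers15)
open Literature.MathematicalPhysics.QuantumFieldTheory.Balaban1983to89.B10CompactBinding (ofPrintedAllXPNC)
open Summit.QuantumFields.Balaban3D.Carriers
open Summit.QuantumFields.Balaban3D.Proofs.Inputs
open Summit.QuantumFields.Balaban3D.Proofs.Primitives (AlphaConsts)
open Summit.QuantumFields.Balaban3D.Proofs.GroupModelLieC (lieC)
open Summit.QuantumFields.Balaban3D.Proofs.UVStability3DInputs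
open Summit.QuantumFields.Balaban3D.Proofs.FamilyLE (ScalesLE)
open Summit.QuantumFields.YangMills.Theorems.BalabanUVNodesN08AlphaClassI
open Summit.QuantumFields.YangMills.Theorems.BalabanUVNodesN08AlphaLoop28
open Summit.QuantumFields.YangMills.Theorems.BalabanUVNodesN08AlphaThreeFaces (regMin gammaN08 b10_main_constructedLE_upC_of_faces₃_family)
open Summit.QuantumFields.YangMills.Theorems.BalabanUVNodesN08AlphaProfileEnd
open B7Prop2Explicit (C0 c2')

variable {L : ℕ} {G : Type} [GaugeGroup G] [MeasurableSpace G] [HaarData G] (𝔊 : GroupModel G) (𝔠 : AlphaConsts L 𝔊.N)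

/-- **★★ N08 BY NAME AT THE C-BINDING OVER THE CONSTRUCTED RUNS OF MINIMISER-SELECTED EXTERNAL INPUTS, FROM THE DATA SCHEMA AND STRUCTURE ALONE.**
[cite: Balaban1985UV3, Thm 1 p.257 (compact reading) + Thm 2 p.272 + (41)–(42) p.266 + (67)–(68) p.273; Balaban1985Variational, Thm 1 p.279; Balaban1985Averaging, Prop. 2 (54) p.26] -/
theorem exists_externalInputs_b10_main_family_of_structure (X₀ : ∀ S : Scales L, ExternalInputs S G)
    (hstd : ∀ S : Scales L, (X₀ S).av = AveragingRT.stdAvg S.P G) (w : ℝ)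
    {X : Matrix (Fin 𝔊.N) (Fin 𝔊.N) ℂ} (hX : X ∈ 𝔊.lie) (hX0 : X ≠ 0) (hC : 4 * Real.pi ≤ (regMin 𝔠).C68)
    (hsm : ∀ (S : Scales L) (j : ℕ), j < S.K → (regMin 𝔠).C68 * (S.gk j * pFun 𝔠.lane.carrier.b₀ 𝔠.lane.carrier.p₀ (S.gk j)) ≤ 1 / 4)
    (hα3 : ∀ (S : Scales L) (j : ℕ), j < S.K → C0 S.P.d * ((regMin 𝔠).C68 * (S.gk j * pFun 𝔠.lane.carrier.b₀ 𝔠.lane.carrier.p₀ (S.gk j))) ≤ 1 / 3)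
    (hα2 : ∀ (S : Scales L) (j : ℕ), j < S.K → 2 * ((regMin 𝔠).C68 * (S.gk j * pFun 𝔠.lane.carrier.b₀ 𝔠.lane.carrier.p₀ (S.gk j))) ≤ c2' S.P.d L)
    (hwin : ∀ (S : Scales L) (j : ℕ), j < S.K → 512 * ((S.P.d : ℝ) + 1) * (S.P.d + 4) * (L : ℝ) ^ 2 *
      (((regMin 𝔠).C68 * (S.gk j * pFun 𝔠.lane.carrier.b₀ 𝔠.lane.carrier.p₀ (S.gk j))) +
        2 * C0 S.P.d * ((regMin 𝔠).C68 * (S.gk j * pFun 𝔠.lane.carrier.b₀ 𝔠.lane.carrier.p₀ (S.gk j))) ^ 2) ≤ 1)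
    (hRc : ∀ (S : Scales L) (j : ℕ), j < S.K → 14 ≤ rcolOf S 𝔠.lane.carrier j)
    (Bk : ∀ (S : Scales L) (k : ℕ), Hist S.P k → Set (PBond S.P k)) :
    ∃ Xe : ∀ S : Scales L, ExternalInputs S G,
      (∀ S, (Xe S).av = AveragingRT.stdAvg S.P G ∧ (Xe S).reg = (X₀ S).reg) ∧ (∀ (S : Scales L) (k : ℕ) (h : Hist S.P k), Measurable ((Xe S).UkH k h)) ∧
      (∀ S, InEdgeFaces₃ 𝔊 (regMin 𝔠) (Xe S)) ∧
      (∀ (S : Scales L) (𝔖 : ∀ k, StepSeries S G ↥(lieC 𝔊) (nblkOf S 𝔠.lane.carrier k) k) (𝔄 : AlphaData 𝔊 𝔠 (Xe S) 𝔖)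
        (coef : (k : ℕ) → Hist S.P (k + 1) → GaugeField S.P (k + 1) G → (j : ℕ) → TermSizes (oldGeom S.P k j)),
        S.g ^ 2 * S.ε₀ ≤ (min (gammaN08 𝔠) 1) ^ 2 → RunDataRows 𝔊 𝔠 (Xe S) 𝔖 𝔄 (sizesOf 𝔊 𝔠 (Xe S) coef) → RunAlpha 𝔊 𝔠 (Xe S) 𝔖 𝔄) ∧
      ∀ (𝔖 : ∀ (S : Scales L) (k : ℕ), StepSeries S G ↥(lieC 𝔊) (nblkOf S 𝔠.lane.carrier k) k)
        (𝔄 : ∀ S : Scales L, AlphaData 𝔊 𝔠 (Xe S) (𝔖 S))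
        (coef : ∀ (S : Scales L) (k : ℕ), Hist S.P (k + 1) → GaugeField S.P (k + 1) G → (j : ℕ) → TermSizes (oldGeom S.P k j))
        (Xc : PrintedCarriersR) (Y : PrintedCarriers9X) (Z : PrintedCarriers11) (V : PrintedCarriers14R) (W : PrintedCarriers15)
        (w' : WorldP) (P : B12.RunParams),
        (∀ S : Scales L, S.g ^ 2 * S.ε₀ ≤ (min (gammaN08 𝔠) 1) ^ 2 →
          RunDataRows 𝔊 𝔠 (Xe S) (𝔖 S) (𝔄 S) (sizesOf 𝔊 𝔠 (Xe S) (coef S))) →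
        w'.up P = ofPrintedAllXPNC (Xc.withTowerRuns10 fun S : ScalesLE L ((min (gammaN08 𝔠) 1) ^ 2) =>
          towerOf 𝔠.lane (Xe S.1) (𝔖 S.1)) Y Z V W →
        Dag.B10_main (leavesP w' P) := by
  have H : ∀ S : Scales L, ∃ Xe : ExternalInputs S G, Xe.av = AveragingRT.stdAvg S.P G ∧ Xe.reg = (X₀ S).reg ∧
      (∀ (k : ℕ) (h : Hist S.P k), Measurable (Xe.UkH k h)) ∧ InEdgeFaces₃ 𝔊 (regMin 𝔠) Xe ∧
      ∀ (𝔖 : ∀ k, StepSeries S G ↥(lieC 𝔊) (nblkOf S 𝔠.lane.carrier k) k) (𝔄 : AlphaData 𝔊 𝔠 Xe 𝔖)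
        (coef : (k : ℕ) → Hist S.P (k + 1) → GaugeField S.P (k + 1) G → (j : ℕ) → TermSizes (oldGeom S.P k j)),
        S.g ^ 2 * S.ε₀ ≤ (min (gammaN08 𝔠) 1) ^ 2 → RunDataRows 𝔊 𝔠 Xe 𝔖 𝔄 (sizesOf 𝔊 𝔠 Xe coef) → RunAlpha 𝔊 𝔠 Xe 𝔖 𝔄 :=
    fun S => exists_externalInputs_runAlpha_of_structure_window 𝔊 𝔠 (X₀ S) (hstd S) w hX hX0 hC (hsm S) (hα3 S) (hα2 S) (hwin S) (hRc S) (Bk S)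
  choose Xe hav hreg hm hF hα using H
  refine ⟨Xe, fun S => ⟨hav S, hreg S⟩, hm, hF, hα, ?_⟩
  intro 𝔖 𝔄 coef Xc Y Z V W w' P hD hup
  exact b10_main_constructedLE_upC_of_faces₃_family (X := Xe) (𝔖 := 𝔖) (𝔄 := 𝔄) (coef := coef) hD (fun S _ => hF S) hup

end Summit.QuantumFields.YangMills.Theorems.BalabanUVNodesN08AlphaProfileFamily

end
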